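import Mathlib
import Summits.Ventures.PercRepro2.Harris
import Summits.Ventures.PercRepro2.Graph

/-!
# The two clusters of one root: «b blue-only ⟹ o rather blue-only than red-only» (blind cell
PercRepro2, p5 g5, 2026-08-25; P5-RULES.md §6.9 (J1b))

A configuration `y` is read as a 2-colouring: `y e = true` = RED, `false` = BLUE; `blue y` is the
complementary configuration. For the root `a₂`, `red ends a₂ v` = «`v` in the red cluster of `a₂`»
(`connEvent`), `blueC ends a₂ v` = «`v` in the blue cluster of `a₂`»; `redOnly v = red v ∖ blueC v`,
`blueOnly v = blueC v ∖ red v`. Under the UNIFORM weights (`half`):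

  `prob half (redOnly o ∩ blueOnly b) ≤ prob half (blueOnly o ∩ blueOnly b)`
  (`prob_redOnly_inter_blueOnly_le`).

Proof: `red v` is an up-set and `blueC v` a down-set (`conn_mono` on the complement), so `redOnly v`
is an up-set and `blueOnly v` a down-set; Harris (the cell's `prob_inter_le_prob_mul_prob_of_isLowerSet`
and `prob_mul_prob_le_prob_inter`) gives `P(blueOnly b ∩ redOnly o) ≤ P(blueOnly b) P(redOnly o)` and
`P(redOnly o) P(redOnly b) ≤ P(redOnly o ∩ redOnly b)`; the colour swap `blue` is an involution
preserving the uniform weight and exchanging `redOnly v ↔ blueOnly v`, so `P(blueOnly b) = P(redOnly b)`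
and `P(redOnly o ∩ redOnly b) = P(blueOnly o ∩ blueOnly b)`.

This is the comparison «(J1) of row 2′TB without the hypotheses `Q` and `b ∈ C(a₁)`»
(P5-RULES.md §6.9); it proves nothing about the row itself. Standard axioms.
-/

namespace Summit.Ventures.PercRepro2

namespace TB14TwoCluster

section Swap

variable {E : Type*}

/-- The complementary colouring (red ↔ blue). -/
def blue (y : Config E) : Config E := fun e => !(y e)

/-- `blue` is an involution. -/
lemma blue_blue (y : Config E) : blue (blue y) = y := by
  funext e; simp [blue]

/-- `blue` is antitone. -/
lemma blue_antitone {y y' : Config E} (h : y ≤ y') : blue y' ≤ blue y := by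
  intro e
  have := h e
  simp only [blue]
  cases hy : y e <;> cases hy' : y' e <;> simp_all

end Swap

section Events

variable {V : Type*} {E : Type*}
variable (ends : E → Sym2 V) (a₂ : V)

/-- «`v` in the red cluster of `a₂`». -/
def red (v : V) : Set (Config E) := connEvent ends a₂ v

/-- «`v` in the blue cluster of `a₂`» (the cluster in the complementary colouring). -/
def blueC (v : V) : Set (Config E) := {y | Conn ends (blue y) a₂ v}

/-- «`v` red-only»: in the red cluster, not in the blue one. -/
def redOnly (v : V) : Set (Config E) := red ends a₂ v ∩ (blueC ends a₂ v)ᶜ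

/-- «`v` blue-only»: in the blue cluster, not in the red one. -/
def blueOnly (v : V) : Set (Config E) := blueC ends a₂ v ∩ (red ends a₂ v)ᶜ

/-- The red cluster event is increasing. -/
lemma isUpperSet_red (v : V) : IsUpperSet (red ends a₂ v) :=
  isUpperSet_connEvent ends a₂ v

/-- The blue cluster event is decreasing (more red edges = fewer blue ones). -/
lemma isLowerSet_blueC (v : V) : IsLowerSet (blueC ends a₂ v) :=
  fun _ _ h hy => conn_mono (blue_antitone h) hy

/-- «Red-only» is increasing. -/
lemma isUpperSet_redOnly (v : V) : IsUpperSet (redOnly ends a₂ v) :=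
  (isUpperSet_red ends a₂ v).inter (isLowerSet_blueC ends a₂ v).compl

/-- «Blue-only» is decreasing. -/
lemma isLowerSet_blueOnly (v : V) : IsLowerSet (blueOnly ends a₂ v) :=
  (isLowerSet_blueC ends a₂ v).inter (isUpperSet_red ends a₂ v).compl

/-- The colour swap exchanges «red-only» and «blue-only»: `y ∈ redOnly v ↔ blue y ∈ blueOnly v`. -/
lemma mem_redOnly_iff_blue_mem_blueOnly (v : V) (y : Config E) :
    y ∈ redOnly ends a₂ v ↔ blue y ∈ blueOnly ends a₂ v := by
  simp only [redOnly, blueOnly, red, blueC, connEvent, Set.mem_inter_iff, Set.mem_compl_iff,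
    Set.mem_setOf_eq, blue_blue]

/-- As sets: `redOnly v = blue ⁻¹' blueOnly v`. -/
lemma redOnly_eq_preimage (v : V) : redOnly ends a₂ v = blue ⁻¹' blueOnly ends a₂ v := by
  ext y
  exact mem_redOnly_iff_blue_mem_blueOnly ends a₂ v y

end Events

section Uniform

variable {E : Type*} [Fintype E] [DecidableEq E]
variable {R : Type*} [Field R] [LinearOrder R] [IsStrictOrderedRing R]

/-- The uniform weights `1/2`. -/
def half : E → R := fun _ => 1 / 2

omit [Fintype E] [DecidableEq E] in
/-- The uniform weights are admissible. -/
lemma isProbVec_half : IsProbVec (half : E → R) :=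
  ⟨fun _ => by norm_num [half], fun _ => by norm_num [half]⟩

omit [DecidableEq E] in
/-- Every configuration has the same uniform weight; in particular the colour swap preserves it. -/
lemma weight_half_blue (y : Config E) : weight (half : E → R) (blue y) = weight half y := by
  unfold weight
  refine Finset.prod_congr rfl fun e _ => ?_
  simp only [half, blue]
  cases y e <;> simp [edgeFactor] <;> norm_num

/-- The uniform probability is invariant under the colour swap. -/
lemma prob_half_preimage_blue (S : Set (Config E)) :
    prob (half : E → R) (blue ⁻¹' S) = prob half S := by
  unfold prob
  have hinv : Function.Involutive (blue : Config E → Config E) := fun y => blue_blue y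
  rw [← Fintype.sum_equiv hinv.toPerm
    (fun y => S.indicator (weight (half : E → R)) (blue y))
    (fun y => S.indicator (weight (half : E → R)) y) (fun y => rfl)]
  refine Finset.sum_congr rfl fun y _ => ?_
  by_cases h : blue y ∈ S
  · rw [Set.indicator_of_mem (show y ∈ blue ⁻¹' S from h), Set.indicator_of_mem h, weight_half_blue]
  · rw [Set.indicator_of_notMem (show y ∉ blue ⁻¹' S from h), Set.indicator_of_notMem h]

end Uniform

section Main

variable {V : Type*} {E : Type*} [Fintype E] [DecidableEq E]
variable {R : Type*} [Field R] [LinearOrder R] [IsStrictOrderedRing R]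
variable (ends : E → Sym2 V) (a₂ b o : V)

/-- The colour swap: `P(redOnly v) = P(blueOnly v)` under the uniform weights. -/
lemma prob_half_redOnly_eq_blueOnly (v : V) :
    prob (half : E → R) (redOnly ends a₂ v) = prob half (blueOnly ends a₂ v) := by
  rw [redOnly_eq_preimage, prob_half_preimage_blue]

/-- The colour swap on the pair: `P(redOnly o ∩ redOnly b) = P(blueOnly o ∩ blueOnly b)`. -/
lemma prob_half_redOnly_inter_eq (o b : V) :
    prob (half : E → R) (redOnly ends a₂ o ∩ redOnly ends a₂ b) =
      prob half (blueOnly ends a₂ o ∩ blueOnly ends a₂ b) := by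
  rw [redOnly_eq_preimage, redOnly_eq_preimage, ← Set.preimage_inter, prob_half_preimage_blue]

/-- **THEOREM (the J1 comparison of row 2′TB without `Q` and without `b ∈ C(a₁)`)**: under the
uniform weights, «`o` red-only and `b` blue-only at `a₂`» is at most «`o` blue-only and `b`
blue-only at `a₂`» — Harris for the two clusters of one root, closed by the colour symmetry. -/
theorem prob_redOnly_inter_blueOnly_le :
    prob (half : E → R) (redOnly ends a₂ o ∩ blueOnly ends a₂ b) ≤
      prob half (blueOnly ends a₂ o ∩ blueOnly ends a₂ b) := by
  have hp : IsProbVec (half : E → R) := isProbVec_half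
  -- Harris, mixed form: a decreasing and an increasing event are negatively correlated
  have h1 : prob (half : E → R) (blueOnly ends a₂ b ∩ redOnly ends a₂ o) ≤
      prob half (blueOnly ends a₂ b) * prob half (redOnly ends a₂ o) :=
    prob_inter_le_prob_mul_prob_of_isLowerSet hp (isLowerSet_blueOnly ends a₂ b)
      (isUpperSet_redOnly ends a₂ o)
  -- Harris, increasing form
  have h2 : prob (half : E → R) (redOnly ends a₂ o) * prob half (redOnly ends a₂ b) ≤
      prob half (redOnly ends a₂ o ∩ redOnly ends a₂ b) :=
    prob_mul_prob_le_prob_inter hp (isUpperSet_redOnly ends a₂ o) (isUpperSet_redOnly ends a₂ b)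
  calc prob (half : E → R) (redOnly ends a₂ o ∩ blueOnly ends a₂ b)
      = prob half (blueOnly ends a₂ b ∩ redOnly ends a₂ o) := by rw [Set.inter_comm]
    _ ≤ prob half (blueOnly ends a₂ b) * prob half (redOnly ends a₂ o) := h1
    _ = prob half (redOnly ends a₂ o) * prob half (redOnly ends a₂ b) := by
        rw [← prob_half_redOnly_eq_blueOnly, mul_comm]
    _ ≤ prob half (redOnly ends a₂ o ∩ redOnly ends a₂ b) := h2
    _ = prob half (blueOnly ends a₂ o ∩ blueOnly ends a₂ b) := prob_half_redOnly_inter_eq ends a₂ o b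

end Main

end TB14TwoCluster

end Summit.Ventures.PercRepro2
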